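import Literature.NumberTheory.EllipticCurves.CyclotomicLayerTatePairing
import Literature.NumberTheory.EllipticCurves.DiscretePairingOfFun
import HarnessLib

/-!
# The local Tate pairing at the LAYERS of a cyclotomic `ℤ_p`-tower for an ARBITRARY finite discrete Galois module `M` with a pairing
# `e : M × M → μ_N` — `⟨x, y⟩_{n,N} = inv_v(Sh_n(x) ∪_{Σe} Sh_n(y)) ∈ ℤ/N` on `H¹(U_n, M|) × H¹(U_n, M|)`
# (the coefficient-generic form of `CyclotomicLayer.layerPairingMod`, there `M = E[N]` and `y = κ_{U_n}(Q)`)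

Topic `NumberTheory/EllipticCurves`, sub-namespace `CyclotomicLayer` (same as the `E[N]` file). Lead prover of route `ResidualThetaTransportAtTwo`
(cell `bsd-wall`, seat `bsd-wall-rtt-p2` g16), item D2(c) of `Summits/…/Cruxes/ResidualThetaCountLowerPureAtTwo/PIN-SPEC-S2-g16.md`: with
`M := A_ρ[N]` (`GreenbergSelmer.cofreeTorsionGaloisModule`, D2(b)), `e` a self-duality pairing of `ρ` (DATA), the first argument a reduced Kato
class (`GreenbergSelmer.reduceH1CofreePkTorsion`, D1) localised, the second the `Θ`-transported Kummer class of the crux's Selmer clause, this is the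
PINNED layer pairing through which the KZ_g HOLD and the (EH)/(DH) supplies of the 22608 line are to be stated. Bodies VERBATIM those of
`CyclotomicLayerTatePairing.lean` §1–§3 with `torsionLocalRep W N v` ↦ `localRepOf ρM v`, `weilLocalPairing` ↦ `localPairingOfFun`, and the
Kummer precomposition dropped (both arguments are classes). DEFINITIONS WITH BODIES + unfolding lemmas; no named fact, no instance, no notation.

References: [Kobayashi2003] (8.23); [PerrinRiou1994Invent] §3.6.1; [MilneADT2006] I §2–§3, §6; [NeukirchSchmidtWingberg2008] I §5–§6.
-/

set_option autoImplicit false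

noncomputable section

open scoped Classical

namespace Literature.NumberTheory.EllipticCurves

namespace CyclotomicLayer

open CategoryTheory Field NumberField IsDedekindDomain
  Literature.NumberTheory.GaloisRepresentations Literature.NumberTheory.GaloisCohomology ZpExtension
open Literature.NumberTheory.GaloisRepresentations.DiscreteGaloisModule (mu MuCarrier pairing)

-- Cup products need `LocallyCompactSpace Γ_v`; as in `CyclotomicLayerTatePairing.lean` / `WeilPairingTateDual.lean` the compactness of absolute Galois
-- groups is a LOCAL instance only (a Prop-valued Mathlib class, no data; same line as in those files).
attribute [local instance] absoluteGaloisGroup_compactSpace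

universe u

variable {M : Type} [AddCommGroup M] [TopologicalSpace M] [DiscreteTopology M] [Finite M]
  (ρM : DiscreteGaloisModule ℚ M) (N : ℕ) [NeZero N]
  (e : M → M → AlgebraicClosure ℚ)
  (hμ : ∀ S T, e S T ^ N = 1)
  (hadd₁ : ∀ S₁ S₂ T, e (S₁ + S₂) T = e S₁ T * e S₂ T)
  (hadd₂ : ∀ S T₁ T₂, e S (T₁ + T₂) = e S T₁ * e S T₂)
  (hgal : ∀ (σ : absoluteGaloisGroup ℚ) (S T : M), σ • e S T = e (ρM σ S) (ρM σ T))
  {p : ℕ} [Fact p.Prime] (κ : ZpExtension ℚ p) (v : HeightOneSpectrum (𝓞 ℚ))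

/-! ## §1 The local coefficient module and the local pairing at `ℚ_v` -/

/-- `M|_{Γ_v}`: the discrete module restricted along `Γ_{ℚ_v} → Γ_ℚ` for the chosen embedding, as a `TopRep` (twin of `torsionLocalRep`).
[cite: MilneADT2006, Ch. I §2] -/
abbrev localRepOf : TopRep ℤ (absoluteGaloisGroup (v.adicCompletion ℚ)) :=
  DiscreteGaloisModule.toTopRep (GaloisRep.restrictField (v.adicCompletion ℚ) ρM)

/-- **The local pairing** `M| × M| → μ_N|` at `ℚ_v` as a continuous equivariant pairing (twin of `weilLocalPairing`, built with the tree's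
`DiscreteGaloisModule.pairing` from `pairingHomOfFun`). [cite: MilneADT2006, Ch. I §2 Cor. 2.3] -/
def localPairingOfFun : ContPairing (localRepOf ρM v) (localRepOf ρM v) (muLocalRep N v) :=
  DiscreteGaloisModule.pairing (GaloisRep.restrictField (v.adicCompletion ℚ) ρM) (GaloisRep.restrictField (v.adicCompletion ℚ) ρM)
    (GaloisRep.restrictField (v.adicCompletion ℚ) (DiscreteGaloisModule.mu ℚ N)) (pairingHomOfFun N e hμ hadd₁ hadd₂) fun σ S T =>
      (contPairingOfFun ρM N e hμ hadd₁ hadd₂ hgal).toLin_smul (absGaloisRestrict ℚ (v.adicCompletion ℚ) σ) S T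

omit [Finite M] in
/-- Unfolding `localPairingOfFun`: its bilinear map is `pairingHomOfFun`. [cite: MilneADT2006, Ch. I §2] -/
@[simp] theorem localPairingOfFun_toLin_apply (S T : M) :
    (localPairingOfFun ρM N e hμ hadd₁ hadd₂ hgal v).toLin S T = pairingHomOfFun N e hμ hadd₁ hadd₂ S T := rfl

/-! ## §2 Localisation and Shapiro at the layer (coefficient module `M`) -/

/-- **Localisation at the layer**: `loc_n : H¹(Γ_n, M) → H¹(U_n, M|)`, pull-back along `U_n → Γ_n` (twin of `layerLoc`).
[cite: Kobayashi2003, (8.23) (p. 18)] -/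
def layerLocOf (n : ℕ) :
    H1 ρM (κ.layerSubgroup n) ⟶ continuousCohomology 1 (subgroupRep (localRepOf ρM v) (layerGroup κ v n)) :=
  ContinuousCohomology.map (resGalSubgroupOfEmb (κ.layerSubgroup n) (closureEmb (K := ℚ) (v.adicCompletion ℚ)))
    (X := subgroupRep ρM.toTopRep (κ.layerSubgroup n))
    (Y := subgroupRep (localRepOf ρM v) (layerGroup κ v n))
    (TopRep.ofHom ⟨ContinuousLinearMap.id ℤ M, fun _ => rfl⟩) 1

/-- **The Shapiro isomorphism at the layer** for the coefficient module `M` (twin of `layerShapiro`).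
[cite: NeukirchSchmidtWingberg2008, I §6 Prop. (1.6.4)] -/
def layerShapiroOf (n : ℕ) :
    continuousCohomology 1 (subgroupRep (localRepOf ρM v) (layerGroup κ v n)) →ₗ[ℤ]
      continuousCohomology 1 (coindFin.{0, 0} (localRepOf ρM v) (layerGroup κ v n)) :=
  shapiroLift (localRepOf ρM v) (layerGroup κ v n) (isOpen_layerGroup κ v n) (layerReps_spec κ v n) (layerReps_one κ v n)

/-- **The summed local pairing at layer `n`** for the coefficient module `M` (twin of `layerSumPairing`).
[cite: NeukirchSchmidtWingberg2008, I §5 Prop. (1.5.3)(iv)] -/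
def layerSumPairingOf (n : ℕ) :
    ContPairing (coindFin.{0, 0} (localRepOf ρM v) (layerGroup κ v n)) (coindFin.{0, 0} (localRepOf ρM v) (layerGroup κ v n))
      (muLocalRep N v) :=
  haveI : Fintype (absoluteGaloisGroup (v.adicCompletion ℚ) ⧸ layerGroup κ v n) := layerFintypeQuot κ v n
  (localPairingOfFun ρM N e hμ hadd₁ hadd₂ hgal v).coindFin (layerGroup κ v n)

/-! ## §3 The two-argument layer pairing modulo `N` on `H¹(U_n, M|)` -/

/-- **The layer pairing modulo `N` on local classes**: `⟨x, y⟩_{n,N} = inv_v(Sh_n(x) ∪_{Σe} Sh_n(y)) ∈ ℤ/N` for `x, y ∈ H¹(U_n, M|)`;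
bi-additive. By Shapiro this is the local Tate pairing of the layer field `ℚ_{n,v}` with coefficients `M` for the pairing `e` (twin of
`layerPairingMod` with both arguments cohomology classes). [cite: Kobayashi2003, (8.23) (p. 18)] [cite: PerrinRiou1994Invent, §3.6.1]
[cite: MilneADT2006, Ch. I §6, proof of Prop. 6.9] -/
def layerPairingH1Of (n : ℕ) :
    continuousCohomology 1 (subgroupRep (localRepOf ρM v) (layerGroup κ v n)) →+
      (continuousCohomology 1 (subgroupRep (localRepOf ρM v) (layerGroup κ v n)) →+ ZMod N) where
  toFun x := (invAt N v).comp
    ((((layerSumPairingOf ρM N e hμ hadd₁ hadd₂ hgal κ v n).cupProduct (layerShapiroOf ρM κ v n x)).toAddMonoidHom.comp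
      (layerShapiroOf ρM κ v n).toAddMonoidHom))
  map_zero' := by
    ext y
    simp only [map_zero, LinearMap.zero_apply, AddMonoidHom.coe_comp, Function.comp_apply, LinearMap.toAddMonoidHom_coe,
      AddMonoidHom.zero_apply]
  map_add' x x' := by
    ext y
    simp only [map_add, LinearMap.add_apply, AddMonoidHom.coe_comp, Function.comp_apply, LinearMap.toAddMonoidHom_coe,
      AddMonoidHom.add_apply]

omit [Finite M] in
/-- Unfolding the two-argument layer pairing. [cite: Kobayashi2003, (8.23) (p. 18)] -/
theorem layerPairingH1Of_apply (n : ℕ) (x y : continuousCohomology 1 (subgroupRep (localRepOf ρM v) (layerGroup κ v n))) :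
    layerPairingH1Of ρM N e hμ hadd₁ hadd₂ hgal κ v n x y =
      invAt N v ((layerSumPairingOf ρM N e hμ hadd₁ hadd₂ hgal κ v n).cupProduct (layerShapiroOf ρM κ v n x) (layerShapiroOf ρM κ v n y)) :=
  rfl

/-- **The layer pairing with a GLOBAL first argument**: `x ∈ H¹(Γ_n, M)` localised by `layerLocOf`, `y ∈ H¹(U_n, M|)` (e.g. a transported Kummer
class): `⟨loc_n x, y⟩_{n,N}`. [cite: Kobayashi2003, (8.23) (p. 18)] -/
def layerPairingOf (n : ℕ) :
    H1 ρM (κ.layerSubgroup n) →+ (continuousCohomology 1 (subgroupRep (localRepOf ρM v) (layerGroup κ v n)) →+ ZMod N) :=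
  (layerPairingH1Of ρM N e hμ hadd₁ hadd₂ hgal κ v n).comp (layerLocOf ρM κ v n).hom.toLinearMap.toAddMonoidHom

omit [Finite M] in
/-- Unfolding `layerPairingOf`. [cite: Kobayashi2003, (8.23) (p. 18)] -/
theorem layerPairingOf_apply (n : ℕ) (x : H1 ρM (κ.layerSubgroup n))
    (y : continuousCohomology 1 (subgroupRep (localRepOf ρM v) (layerGroup κ v n))) :
    layerPairingOf ρM N e hμ hadd₁ hadd₂ hgal κ v n x y =
      layerPairingH1Of ρM N e hμ hadd₁ hadd₂ hgal κ v n (layerLocOf ρM κ v n x) y :=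
  rfl

end CyclotomicLayer

end Literature.NumberTheory.EllipticCurves

end
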